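import Literature.NumberTheory.LFunctions.WeilMarkovQuadratic
import HarnessLib

/-!
# Moments of the archimedean jump density as finite exponential sums with a two-sided remainder

Topic `Literature/NumberTheory/LFunctions`.  The archimedean density of the windowed Weil form,
`ρ(t) = weilArchDensity t = e^{t/2}/(2 sinh t) = e^{-t/2}/(1 − e^{-2t})`, splits for every
`M : ℕ` and `t > 0` into a FINITE exponential sum and a positive remainder,

  `ρ(t) = Σ_{m<M} e^{−(2m+½)t} + e^{−(2M+½)t}/(1 − e^{−2t})`,   `0 ≤ remainder ≤ e^{−(2M+½)t} (1 + 1/(2t))`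

(`weilArchDensity_eq_sum_add_rem`, `weilArchDensity_rem_nonneg`, `weilArchDensity_rem_le`; the upper bound is
`e^{2t} ≥ 1 + 2t`).  Against a power `t^n`, `n ≥ 1`, the terms integrate in closed form
(`integral_pow_mul_exp_neg_mul`: `∫_0^L t^n e^{−at} dt = n!/a^{n+1} − e^{−aL} Σ_{j≤n} n! L^j/(j! a^{n+1−j})`, `a > 0`), so the
ρ-MOMENTS `∫_0^L t^n ρ(t) dt` — the universal constants of every explicit energy / window-image computation on a window `[-b, b]`
(`L = 2b`: the archimedean part `∫_0^{2b} ρ(t) D_t(u,v) dt = Σ_n d_n ∫_0^{2b} t^n ρ` of the bilinear Weil energy of polynomial ×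
indicator vectors; the deflated Temple L-sides of GroundBarta rung 4 / the parity ladder beyond `log 2`) — are enclosed two-sidedly
by FINITE EXPONENTIAL SUMS with rational data (`setIntegral_pow_mul_weilArchDensity_mem`), certifiable by the kernel with
`Literature/Analysis/ValidatedNumerics/ExpSumEnclosure.lean`.  All proved; no named facts.

## References
* E. Bombieri, *Remarks on Weil's quadratic functional in the theory of prime numbers I*, Rend. Mat. Acc. Lincei (9) 11 (2000),
  Thm 2 (the archimedean density). [Bombieri2000Weil]
* [folklore] (incomplete gamma integrals of integer order).
-/

noncomputable section

open Real Set MeasureTheory Finset intervalIntegral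
open scoped BigOperators Topology

namespace Literature.NumberTheory.LFunctions

/-! ## The finite exponential split of `ρ` -/

/-- The remainder of the split: `e^{−(2M+½)t}/(1 − e^{−2t})`. [folklore] -/
def weilArchDensityRem (M : ℕ) (t : ℝ) : ℝ :=
  Real.exp (-((2 * M + 1 / 2) * t)) / (1 - Real.exp (-(2 * t)))

/-- **Finite exponential split of the archimedean density**: for `t > 0` and every `M`,
`ρ(t) = Σ_{m<M} e^{−(2m+½)t} + e^{−(2M+½)t}/(1 − e^{−2t})`. [cite: Bombieri2000Weil, Thm 2 (p. 193), geometric series of e^{-t/2}/(1-e^{-2t})] -/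
theorem weilArchDensity_eq_sum_add_rem {t : ℝ} (ht : 0 < t) (M : ℕ) :
    weilArchDensity t = (∑ m ∈ Finset.range M, Real.exp (-((2 * m + 1 / 2) * t))) + weilArchDensityRem M t := by
  set q : ℝ := Real.exp (-(2 * t)) with hq
  have hq1 : q < 1 := by rw [hq]; exact Real.exp_lt_one_iff.2 (by linarith)
  have hq0 : 0 < q := Real.exp_pos _
  have hden : 1 - q ≠ 0 := by linarith
  have hterm : ∀ m : ℕ, Real.exp (-((2 * m + 1 / 2) * t)) = Real.exp (-(t / 2)) * q ^ m := by
    intro m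
    rw [hq, ← Real.exp_nat_mul, ← Real.exp_add]
    congr 1
    ring
  have hrem : weilArchDensityRem M t = Real.exp (-(t / 2)) * q ^ M / (1 - q) := by
    unfold weilArchDensityRem
    rw [show (2 * (M : ℝ) + 1 / 2) * t = ((2 * M + 1 / 2) * t) by rfl, hterm M]
  -- `ρ(t) = e^{-t/2}/(1 − e^{-2t})` (the two printed shapes of Bombieri's density; cf. `weilArchDensity_eq_exp_div`)
  have hrho : weilArchDensity t = Real.exp (-(t / 2)) / (1 - q) := by
    have hs : Real.sinh t ≠ 0 := (Real.sinh_pos_iff.2 ht).ne'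
    unfold weilArchDensity
    rw [div_eq_div_iff (mul_ne_zero two_ne_zero hs) hden, Real.sinh_eq, hq]
    have e1 : Real.exp (t / 2) * Real.exp (-(2 * t)) = Real.exp (-(t / 2)) * Real.exp (-t) := by
      rw [← Real.exp_add, ← Real.exp_add]; ring_nf
    have e2 : Real.exp (-(t / 2)) * Real.exp t = Real.exp (t / 2) := by
      rw [← Real.exp_add]; ring_nf
    calc Real.exp (t / 2) * (1 - Real.exp (-(2 * t)))
        = Real.exp (t / 2) - Real.exp (t / 2) * Real.exp (-(2 * t)) := by ring
      _ = Real.exp (-(t / 2)) * Real.exp t - Real.exp (-(t / 2)) * Real.exp (-t) := by rw [e1, e2]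
      _ = Real.exp (-(t / 2)) * (2 * ((Real.exp t - Real.exp (-t)) / 2)) := by ring
  have hden' : q - 1 ≠ 0 := by intro h; apply hden; linarith
  rw [hrho, hrem, Finset.sum_congr rfl fun m _ ↦ hterm m, ← Finset.mul_sum, geom_sum_eq hq1.ne M,
    show (q ^ M - 1) / (q - 1) = (1 - q ^ M) / (1 - q) by rw [div_eq_div_iff hden' hden]; ring]
  field_simp
  ring

/-- The remainder is non-negative (`t > 0`). [folklore] -/
theorem weilArchDensityRem_nonneg {t : ℝ} (ht : 0 < t) (M : ℕ) : 0 ≤ weilArchDensityRem M t := by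
  unfold weilArchDensityRem
  have hq1 : Real.exp (-(2 * t)) < 1 := Real.exp_lt_one_iff.2 (by linarith)
  exact div_nonneg (Real.exp_pos _).le (by linarith)

/-- The remainder is at most `e^{−(2M+½)t} (1 + 1/(2t))` (`t > 0`; from `e^{2t} ≥ 1 + 2t`). [folklore] -/
theorem weilArchDensityRem_le {t : ℝ} (ht : 0 < t) (M : ℕ) :
    weilArchDensityRem M t ≤ Real.exp (-((2 * M + 1 / 2) * t)) * (1 + 1 / (2 * t)) := by
  unfold weilArchDensityRem
  set q : ℝ := Real.exp (-(2 * t)) with hq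
  have hq1 : q < 1 := by rw [hq]; exact Real.exp_lt_one_iff.2 (by linarith)
  have hq0 : 0 < q := Real.exp_pos _
  have hE : 0 < Real.exp (-((2 * M + 1 / 2) * t)) := Real.exp_pos _
  -- `1/(1 − q) ≤ 1 + 1/(2t)` ⟺ `2t ≤ (2t + 1)(1 − q)` ⟺ `(2t+1) q ≤ 1` ⟸ `(1 + 2t) ≤ e^{2t}`.
  have hexp : 1 + 2 * t ≤ Real.exp (2 * t) := by linarith [Real.add_one_le_exp (2 * t)]
  have hqinv : q * Real.exp (2 * t) = 1 := by rw [hq, ← Real.exp_add]; simp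
  have hkey : (2 * t + 1) * q ≤ 1 := by nlinarith [hq0]
  rw [div_le_iff₀ (by linarith)]
  have h2t : 0 < 2 * t := by linarith
  have : Real.exp (-((2 * M + 1 / 2) * t)) * (1 + 1 / (2 * t)) * (1 - q) =
      Real.exp (-((2 * M + 1 / 2) * t)) * (((2 * t + 1) * (1 - q)) / (2 * t)) := by
    field_simp
  rw [this]
  have hfrac : 1 ≤ ((2 * t + 1) * (1 - q)) / (2 * t) := by
    rw [le_div_iff₀ h2t]; nlinarith
  nlinarith

/-! ## The incomplete gamma integrals of integer order -/

/-- The polynomial `P_n(a, L) = Σ_{j ≤ n} n! L^j / (j! a^{n+1−j})` (so that `−e^{−aL} P_n(a,L)` is a primitive of `L^n e^{−aL}`). [folklore] -/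
def incGammaPoly (n : ℕ) (a L : ℝ) : ℝ :=
  ∑ j ∈ Finset.range (n + 1), (n.factorial : ℝ) * L ^ j / ((j.factorial : ℝ) * a ^ (n + 1 - j))

/-- The primitive: `d/dL (−e^{−aL} P_n(a,L)) = L^n e^{−aL}` (`a ≠ 0`). [folklore] -/
theorem hasDerivAt_incGammaPrimitive (n : ℕ) {a : ℝ} (ha : a ≠ 0) (L : ℝ) :
    HasDerivAt (fun x ↦ -Real.exp (-(a * x)) * incGammaPoly n a x) (L ^ n * Real.exp (-(a * L))) L := by
  -- derivative of the polynomial part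
  have hP : HasDerivAt (fun x ↦ incGammaPoly n a x)
      (∑ j ∈ Finset.range (n + 1), (n.factorial : ℝ) * ((j : ℝ) * L ^ (j - 1)) / ((j.factorial : ℝ) * a ^ (n + 1 - j))) L := by
    unfold incGammaPoly
    refine HasDerivAt.fun_sum fun j _ ↦ ?_
    have h := (hasDerivAt_pow j L).const_mul (n.factorial : ℝ)
    have h2 := h.div_const ((j.factorial : ℝ) * a ^ (n + 1 - j))
    simpa [mul_comm, mul_assoc, mul_left_comm] using h2
  have h1 : HasDerivAt (fun x ↦ -(a * x)) (-(a * 1)) L := ((hasDerivAt_id L).const_mul a).neg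
  have h2 : HasDerivAt (fun x ↦ Real.exp (-(a * x))) (Real.exp (-(a * L)) * (-(a * 1))) L := h1.exp
  have hE : HasDerivAt (fun x ↦ -Real.exp (-(a * x))) (-(Real.exp (-(a * L)) * (-(a * 1)))) L := h2.neg
  have hprod := hE.mul hP
  refine hprod.congr_deriv ?_
  -- algebra: a e^{-aL} P − e^{-aL} P' = L^n e^{-aL}
  have hsum : a * incGammaPoly n a L -
      ∑ j ∈ Finset.range (n + 1), (n.factorial : ℝ) * ((j : ℝ) * L ^ (j - 1)) / ((j.factorial : ℝ) * a ^ (n + 1 - j)) = L ^ n := by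
    unfold incGammaPoly
    rw [Finset.mul_sum, Finset.sum_range_succ,
      Finset.sum_range_succ' (fun j ↦ (n.factorial : ℝ) * ((j : ℝ) * L ^ (j - 1)) / ((j.factorial : ℝ) * a ^ (n + 1 - j)))]
    have hpair : ∀ j ∈ Finset.range n, a * ((n.factorial : ℝ) * L ^ j / ((j.factorial : ℝ) * a ^ (n + 1 - j))) =
        (n.factorial : ℝ) * (((j + 1 : ℕ) : ℝ) * L ^ (j + 1 - 1)) / (((j + 1).factorial : ℝ) * a ^ (n + 1 - (j + 1))) := by
      intro j hj
      have hjn : j < n := Finset.mem_range.1 hj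
      have e1 : n + 1 - j = (n - j) + 1 := by omega
      have e2 : n + 1 - (j + 1) = n - j := by omega
      rw [e1, e2, Nat.factorial_succ, pow_succ, Nat.add_sub_cancel]
      push_cast
      have hj1 : ((j : ℝ) + 1) ≠ 0 := by positivity
      have hjf : (j.factorial : ℝ) ≠ 0 := by positivity
      have hap : a ^ (n - j) ≠ 0 := pow_ne_zero _ ha
      field_simp
    rw [Finset.sum_congr rfl hpair, show n + 1 - n = 1 by omega, pow_one]
    have hnf : (n.factorial : ℝ) ≠ 0 := by positivity
    simp only [Nat.cast_zero, zero_mul, mul_zero, zero_div, add_zero]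
    field_simp
    ring
  calc -(Real.exp (-(a * L)) * (-(a * 1))) * incGammaPoly n a L +
        -Real.exp (-(a * L)) * ∑ j ∈ Finset.range (n + 1), (n.factorial : ℝ) * ((j : ℝ) * L ^ (j - 1)) / ((j.factorial : ℝ) * a ^ (n + 1 - j))
      = Real.exp (-(a * L)) * (a * incGammaPoly n a L -
          ∑ j ∈ Finset.range (n + 1), (n.factorial : ℝ) * ((j : ℝ) * L ^ (j - 1)) / ((j.factorial : ℝ) * a ^ (n + 1 - j))) := by ring
    _ = L ^ n * Real.exp (-(a * L)) := by rw [hsum]; ring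

/-- `P_n(a, 0) = n!/a^{n+1}`. [folklore] -/
theorem incGammaPoly_zero (n : ℕ) (a : ℝ) : incGammaPoly n a 0 = (n.factorial : ℝ) / a ^ (n + 1) := by
  unfold incGammaPoly
  rw [Finset.sum_range_succ']
  simp

/-- **The incomplete gamma integral of integer order**: for any `a ≠ 0` and any `L`,
`∫_0^L t^n e^{−at} dt = n!/a^{n+1} − e^{−aL} P_n(a, L)`. [folklore] -/
theorem integral_pow_mul_exp_neg_mul (n : ℕ) {a : ℝ} (ha : a ≠ 0) (L : ℝ) :
    ∫ t in (0 : ℝ)..L, t ^ n * Real.exp (-(a * t)) =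
      (n.factorial : ℝ) / a ^ (n + 1) - Real.exp (-(a * L)) * incGammaPoly n a L := by
  have hderiv : ∀ x ∈ uIcc (0 : ℝ) L,
      HasDerivAt (fun x ↦ -Real.exp (-(a * x)) * incGammaPoly n a x) (x ^ n * Real.exp (-(a * x))) x :=
    fun x _ ↦ hasDerivAt_incGammaPrimitive n ha x
  have hcont : Continuous fun x : ℝ ↦ x ^ n * Real.exp (-(a * x)) := by fun_prop
  rw [integral_eq_sub_of_hasDerivAt hderiv (hcont.intervalIntegrable _ _), incGammaPoly_zero]
  simp
  ring

/-! ## The ρ-moments as exponential sums with a two-sided remainder -/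

/-- `t ↦ t^n e^{−at}` is continuous, hence interval integrable on any `[0, L]`. [folklore] -/
theorem intervalIntegrable_pow_mul_exp (n : ℕ) (a : ℝ) (L : ℝ) :
    IntervalIntegrable (fun t : ℝ ↦ t ^ n * Real.exp (-(a * t))) volume 0 L :=
  (by fun_prop : Continuous fun t : ℝ ↦ t ^ n * Real.exp (-(a * t))).intervalIntegrable _ _

/-- **Lower bound of the ρ-moments by a finite exponential sum**: for `n ≥ 1`, `0 < L` and every `M`,
`Σ_{m<M} ∫_0^L t^n e^{−(2m+½)t} dt ≤ ∫_{(0,L]} t^n ρ(t) dt`, provided `t ↦ t^n ρ(t)` is integrable on `(0, L]`. [folklore] -/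
theorem sum_integral_le_setIntegral_pow_mul_weilArchDensity {n : ℕ} {L : ℝ} (hL : 0 < L) (M : ℕ)
    (hint : IntegrableOn (fun t : ℝ ↦ t ^ n * weilArchDensity t) (Ioc 0 L)) :
    ∑ m ∈ Finset.range M, ∫ t in (0 : ℝ)..L, t ^ n * Real.exp (-((2 * m + 1 / 2) * t)) ≤
      ∫ t in Ioc 0 L, t ^ n * weilArchDensity t := by
  have hmint : ∀ m ∈ Finset.range M, IntervalIntegrable (fun t : ℝ ↦ t ^ n * Real.exp (-((2 * (m : ℝ) + 1 / 2) * t))) volume 0 L :=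
    fun m _ ↦ intervalIntegrable_pow_mul_exp n _ L
  rw [← intervalIntegral.integral_finsetSum hmint, intervalIntegral.integral_of_le hL.le]
  refine setIntegral_mono_on ?_ hint measurableSet_Ioc fun t ht ↦ ?_
  · exact ((by fun_prop : Continuous fun t : ℝ ↦ ∑ m ∈ Finset.range M, t ^ n * Real.exp (-((2 * (m : ℝ) + 1 / 2) * t))).integrableOn_Icc).mono_set Ioc_subset_Icc_self
  · have hsplit := weilArchDensity_eq_sum_add_rem ht.1 M
    have hrem := weilArchDensityRem_nonneg ht.1 M
    have htn : 0 ≤ t ^ n := pow_nonneg ht.1.le n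
    calc ∑ m ∈ Finset.range M, t ^ n * Real.exp (-((2 * (m : ℝ) + 1 / 2) * t))
        = t ^ n * ∑ m ∈ Finset.range M, Real.exp (-((2 * (m : ℝ) + 1 / 2) * t)) := by rw [Finset.mul_sum]
      _ ≤ t ^ n * weilArchDensity t := by rw [hsplit]; nlinarith

/-- **Upper bound of the ρ-moments by a finite exponential sum plus the remainder terms**: for `n ≥ 1`, `0 < L`, every `M`,
`∫_{(0,L]} t^n ρ(t) dt ≤ Σ_{m<M} ∫_0^L t^n e^{−(2m+½)t} + ∫_0^L t^n e^{−(2M+½)t} + ½ ∫_0^L t^{n−1} e^{−(2M+½)t}`. [folklore] -/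
theorem setIntegral_pow_mul_weilArchDensity_le {n : ℕ} (hn : 1 ≤ n) {L : ℝ} (hL : 0 < L) (M : ℕ)
    (hint : IntegrableOn (fun t : ℝ ↦ t ^ n * weilArchDensity t) (Ioc 0 L)) :
    ∫ t in Ioc 0 L, t ^ n * weilArchDensity t ≤
      (∑ m ∈ Finset.range M, ∫ t in (0 : ℝ)..L, t ^ n * Real.exp (-((2 * m + 1 / 2) * t))) +
        (∫ t in (0 : ℝ)..L, t ^ n * Real.exp (-((2 * M + 1 / 2) * t))) +
        1 / 2 * ∫ t in (0 : ℝ)..L, t ^ (n - 1) * Real.exp (-((2 * M + 1 / 2) * t)) := by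
  -- the majorant g(t) = t^n Σ_{m<M} e^{..} + t^n e^{-(2M+1/2)t} + (1/2) t^{n-1} e^{-(2M+1/2)t}
  set g : ℝ → ℝ := fun t ↦ (∑ m ∈ Finset.range M, t ^ n * Real.exp (-((2 * (m : ℝ) + 1 / 2) * t))) +
      t ^ n * Real.exp (-((2 * (M : ℝ) + 1 / 2) * t)) + 1 / 2 * (t ^ (n - 1) * Real.exp (-((2 * (M : ℝ) + 1 / 2) * t))) with hg
  have hgc : Continuous g := by rw [hg]; fun_prop
  have hgi : IntegrableOn g (Ioc 0 L) := (hgc.integrableOn_Icc).mono_set Ioc_subset_Icc_self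
  have hle : ∀ t ∈ Ioc (0 : ℝ) L, t ^ n * weilArchDensity t ≤ g t := by
    intro t ht
    have ht0 : 0 < t := ht.1
    have htn : 0 ≤ t ^ n := pow_nonneg ht0.le n
    rw [weilArchDensity_eq_sum_add_rem ht0 M, mul_add, hg]
    simp only
    have hrem := weilArchDensityRem_le ht0 M
    have hE : 0 ≤ Real.exp (-((2 * (M : ℝ) + 1 / 2) * t)) := (Real.exp_pos _).le
    have hpow : t ^ n * (1 / (2 * t)) = 1 / 2 * t ^ (n - 1) := by
      have : t ^ n = t ^ (n - 1) * t := by rw [← pow_succ]; congr 1; omega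
      rw [this]; field_simp
    have h1 : t ^ n * weilArchDensityRem M t ≤
        t ^ n * Real.exp (-((2 * (M : ℝ) + 1 / 2) * t)) + 1 / 2 * (t ^ (n - 1) * Real.exp (-((2 * (M : ℝ) + 1 / 2) * t))) := by
      calc t ^ n * weilArchDensityRem M t
          ≤ t ^ n * (Real.exp (-((2 * (M : ℝ) + 1 / 2) * t)) * (1 + 1 / (2 * t))) := mul_le_mul_of_nonneg_left hrem htn
        _ = t ^ n * Real.exp (-((2 * (M : ℝ) + 1 / 2) * t)) +
              (t ^ n * (1 / (2 * t))) * Real.exp (-((2 * (M : ℝ) + 1 / 2) * t)) := by ring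
        _ = _ := by rw [hpow]; ring
    rw [Finset.mul_sum]
    linarith
  calc ∫ t in Ioc 0 L, t ^ n * weilArchDensity t ≤ ∫ t in Ioc 0 L, g t :=
        setIntegral_mono_on hint hgi measurableSet_Ioc hle
    _ = _ := by
        rw [← intervalIntegral.integral_of_le hL.le, hg]
        simp only
        rw [intervalIntegral.integral_add, intervalIntegral.integral_add, intervalIntegral.integral_const_mul,
          intervalIntegral.integral_finsetSum]
        · intro m _; exact intervalIntegrable_pow_mul_exp n _ L
        · exact (by fun_prop : Continuous fun t : ℝ ↦ ∑ m ∈ Finset.range M, t ^ n * Real.exp (-((2 * (m : ℝ) + 1 / 2) * t))).intervalIntegrable _ _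
        · exact intervalIntegrable_pow_mul_exp n _ L
        · exact ((by fun_prop : Continuous fun t : ℝ ↦ ∑ m ∈ Finset.range M, t ^ n * Real.exp (-((2 * (m : ℝ) + 1 / 2) * t))).intervalIntegrable _ _).add
            (intervalIntegrable_pow_mul_exp n _ L)
        · exact (intervalIntegrable_pow_mul_exp (n - 1) _ L).const_mul _

end Literature.NumberTheory.LFunctions

end
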